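import Summits.Schanuel.Schanuel.Theses.DiophantineDichotomy
import Summits.Schanuel.Schanuel.Theorems.DiophantineDichotomyApproximationPropertyPointAPThreeMid
import Summits.Schanuel.Schanuel.Theorems.DiophantineDichotomyApproximationPropertyLowSurfaceOr
import Summits.Schanuel.Schanuel.Theorems.DiophantineDichotomyApproximationPropertyPrimePartSplit
import Summits.Schanuel.Schanuel.Theorems.DiophantineDichotomyApproximationPropertySmallLowSurfaceOr
import Summits.Schanuel.Schanuel.Theorems.DiophantineDichotomyApproximationPropertyMidLowSmallNormalForm

/-!
# Line `orbit-interpolation-determinant` — crux `ApproximationProperty` (stmt-Schanuel-6117), skeleton v28b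

Checked skeleton of the line lead `prover-line-stmt-Schanuel-6117-c14-0` (2026-08-17, continuation c14).

## v28 (lead c14): the Q₂-NORMAL FORM of the mid-low-small kernel

v27b's open stub `pointDatum_of_midLowSmall3` knows that the satellite `𝔮'` lies on a SMALL cheap prime surface `Q₂`
of degree `a₂ ≤ Δ/M₁` (KERNEL-c13.md §2) but leaves the two elementary consequences of KERNEL-c13.md §2(i)(ii)
unrecorded. They are made formal here as the provable stub `midLowSmall3_normalForm` (landed Bézout lemmas
`ideg_le_mul_of_rankTwo` p152847 and `ideg_le_mul_of_rankOne` p163575, plus degree bookkeeping for `Q ∣ Q₂`):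
* `deg 𝔮' ≤ 2Δ·a₂ (≤ 2Δ²/M₁)`: if `Q₂ ∉ (Q)` the satellite is a minimal prime of the c.i. `(Q, Q₂)` of bidegree
  `(a, a₂)`, so `deg 𝔮' ≤ a·a₂ ≤ Δ a₂`; if `Q₂ ∈ (Q)` then `Q ∣ Q₂` forces `a ≤ a₂`, so the cut-1 surface itself has
  degree `a ≤ Δ/M₁` and `deg 𝔮' ≤ a·b ≤ 2Δ a₂`. The free parameter `η` of v24–v27b (`deg 𝔮' < ηΔ²`) is therefore
  REDUNDANT and is dropped from the open stub;
* the split on `Q₂ ∈ 𝔮`: EITHER the selected small curve `C = V(𝔮)` lies itself on the small low surface `V(Q₂)` —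
  then `deg 𝔮 ≤ 2Δ·a₂ ≤ 2Δ²/M₁` (the descent selected an `M₁`-times thinner curve than generic) — OR `Q₂ ∉ 𝔮`,
  `Q₂ ∈ 𝔭`: the bad orbit is (part of) the cut of the selected curve by the small cheap low surface, and
  `D = deg 𝔭 ≤ deg 𝔮 · a₂ ≤ 2Δ³/M₁` (Bézout one rank down).
The open stub becomes `pointDatum_of_midLowSmall3NF` = v27b's stub WITHOUT `η` and WITH the three normal-form conjuncts
inside its low-surface hypothesis (statement weaker than v27b's: more hypotheses, one vacuous parameter removed); v27b's
`pointDatum_of_midLowSmall3` is PROVED below from the two (with `η := 1`), and the rest of the composition is v27b's,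
over the LANDED record …PointAPThreeMid.lean (p154747).
Sorries (v28b): `pointDatum_of_midLowSmall3NF` (OPEN: the mid-low-small configuration in normal form ≈ the residue of
Philippon's AP2 at n = 3, KERNEL-c13.md §3 / KERNEL-c14.md), `stub_pointAP_four_le` (OPEN: Philippon's conjecture n ≥ 4,
LNM 1752 Ch. 4 §4 p. 61; not staffed). v28's provable stub `midLowSmall3_normalForm` LANDED in wave 1 of c14 (p166175,
…MidLowSmallNormalForm.lean) and is imported by name.

## v27/v27b (lead c13): SMALLNESS SPLITTING of the low-surface form (`primePartSplit3` p159802,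
`pointDatum_or_smallLowSurface3_of` p162261, record …PointAPThreeMidSmall.lean p162641)
## v26b (lead c12): the mid stub gained the LOW-SURFACE hypothesis (`pointDatum_or_lowSurface3`, p155505)
## v25/v24 (lead c12): the far kernel SPLIT at satellite degree `ηΔ²`; top range LANDED (…HighSatelliteOf, …PointAPThreeMid)

See the tree copies' history, KERNEL-c12.md, KERNEL-c13.md, KERNEL-c14.md; v23b and earlier:
`Cruxes/ApproximationProperty/NOTES.md`, KERNEL-c5 … c11.
-/

set_option linter.dupNamespace false

namespace Summit.Schanuel.Schanuel.Cruxes.ApproximationProperty.OrbitInterpolationDeterminant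

open Summit.Schanuel.Schanuel.Theses.DiophantineDichotomy
open Literature.NumberTheory.Transcendental.Nesterenko MvPolynomial
open scoped BigOperators

attribute [local instance] MvPolynomial.gradedAlgebra

noncomputable section

/-! ## The registered OPEN stubs -/

/-- **Stub `pointDatum_of_midLowSmall3NF` — THE OPEN KERNEL of the `t = 3` transfer after v28, in Q₂-normal form**:
v27b's mid-low-small stub (far ∧ thin ∧ enveloped ∧ `K₀`-deficient satellite `𝔮'` of degree `> δ⋆`, long orbit
failing the clause, the satellite on a prime surface `Q₂` of degree `a₂ ≤ d ≤ Δ/M₁` dividing a Dirichlet form `F` of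
height `≤ λY/c₁`, with `h(Q₂) ≤ λY/c₁ + 4Δ/M₁` and `‖Q₂‖_ω̄ ≤ exp(−a₂ (Δ/M₁)² λY/(3200 c₁))`) WITHOUT the parameter `η`
and WITH the normal-form conjuncts `deg 𝔮' ≤ 2Δ·a₂`, `Q₂ ∈ (Q) → a ≤ Δ/M₁`, and
`(Q₂ ∈ 𝔮 ∧ deg 𝔮 ≤ 2Δ·a₂) ∨ (Q₂ ∉ 𝔮 ∧ deg 𝔭 ≤ deg 𝔮 · a₂)` — for the `M₁ ≥ 64c₁` of our choice the bad configuration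
is `M₁`-times degenerate in one of two explicit ways (the selected small curve lies on the small low surface and is
`M₁`-times thinner than generic, or the bad orbit is a cut of the selected curve by the small low surface and is
`M₁`-times shorter than generic). Implied outright by `PointAPAbsAt 3` at `ω`: a structure target, not a refutation
target. Why it might fail: it is (the residual of) an open problem (Philippon's AP2 at `n = 3`, mid-low-small
configuration; KERNEL-c13.md §3, KERNEL-c14.md). -/
theorem pointDatum_of_midLowSmall3NF : ∀ (ω : Fin 3 → ℂ) (c₁ : ℝ), 1 ≤ c₁ → ∃ δstar : ℕ, 1 ≤ δstar ∧ ∃ K₀ : ℕ, 1 ≤ K₀ ∧ ∃ C₄ : ℝ, c₁ ≤ C₄ ∧ ∃ M₁ : ℝ, 64 * c₁ ≤ M₁ ∧ ∃ lam : ℝ, 1 ≤ lam ∧ ∃ c : ℝ, c₁ ≤ c ∧ ∀ Δ Y : ℝ, c ≤ Δ → Δ ≤ Y → ∀ (Q : Rx 3) (a : ℕ) (P : Rx 3) (b : ℕ) (𝔮 : Ideal (Rx 3)) (T : Rx 3) (τ : ℕ) (𝔭 𝔮' : Ideal (Rx 3)), CycleAP3Datum ω c₁ Δ (lam * Y) Q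 a P b 𝔮 T τ 𝔭 → 𝔮'.IsPrime → 𝔮'.IsHomogeneous (homogeneousSubmodule (Fin (3 + 1)) ℚ) → IsUnmixedOfRank 𝔮' 2 → 𝔮' ∈ (Ideal.span {Q} ⊔ Ideal.span {P}).minimalPrimes → Ideal.span {Q} ⊔ Ideal.span {P} ⊔ Ideal.span {T} ≤ 𝔮' → 𝔮' < 𝔭 → δstar < ideg 𝔮' 2 → a + b + ⌊Δ⌋₊ ≤ τ → Module.finrank ℚ ↥(homogeneousSubmodule (Fin (3 + 1)) ℚ τ) < Module.finrank ℚ ↥(homogeneousSubmodule (Fin (3 + 1)) ℚ τ ⊓ 𝔮'.restrictScalars ℚ) + 2 * ⌊Δ⌋₊ * ideg 𝔮 2 → ⌊c₁ * Δ⌋₊ + 1 < ideg 𝔭 1 → ¬ (Module.finrank ℚ ↥(homogeneousSubmodule (Fin (3 + 1)) ℚ ⌊c₁ * Δ⌋₊) = Module.finrank ℚ ↥(homogeneousSubmodule (Fin (3 + 1)) ℚ ⌊c₁ * Δ⌋₊ ⊓ 𝔭.restrictScalars ℚ) + ideg 𝔭 1) → homogeneousSubmodule (Fin (3 + 1)) ℚ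 ⌊C₄ * Δ⌋₊ ⊓ 𝔭.restrictScalars ℚ ≤ 𝔮'.restrictScalars ℚ → K₀ * Module.finrank ℚ ↥(homogeneousSubmodule (Fin (3 + 1)) ℚ ⌊C₄ * Δ⌋₊) < ideg 𝔭 1 + K₀ * Module.finrank ℚ ↥(homogeneousSubmodule (Fin (3 + 1)) ℚ ⌊C₄ * Δ⌋₊ ⊓ 𝔭.restrictScalars ℚ) → (∃ (F Q₂ : Rx 3) (d a₂ : ℕ), F ≠ 0 ∧ F.IsHomogeneous d ∧ 1 ≤ d ∧ (d : ℝ) ≤ Δ / M₁ ∧ height F ≤ lam * Y / c₁ ∧ Q₂ ≠ 0 ∧ Q₂.IsHomogeneous a₂ ∧ 1 ≤ a₂ ∧ a₂ ≤ d ∧ (Ideal.span {Q₂}).IsPrime ∧ Q₂ ∣ F ∧ Q₂ ∈ 𝔮' ∧ height Q₂ ≤ lam * Y / c₁ + 4 * Δ / M₁ ∧ normAt (Fin.cons 1 ω) Q₂ ≤ Real.exp (-((a₂ : ℝ) * (Δ / M₁) ^ 2 * (lam * Y) / (3200 * c₁))) ∧ (ideg 𝔮' 2 : ℝ) ≤ 2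 * Δ * a₂ ∧ (Q₂ ∈ Ideal.span {Q} → (a : ℝ) ≤ Δ / M₁) ∧ ((Q₂ ∈ 𝔮 ∧ (ideg 𝔮 2 : ℝ) ≤ 2 * Δ * a₂) ∨ (Q₂ ∉ 𝔮 ∧ ideg 𝔭 1 ≤ ideg 𝔮 2 * a₂))) → ∃ (K : Type) (_ : Field K) (_ : NumberField K) (β : Fin 3 → K) (σ : K →+* ℂ), (Module.finrank ℚ K : ℝ) ≤ (c * Δ) ^ 3 ∧ Height.logHeight (Fin.cons (1 : K) β : Fin (3 + 1) → K) ≤ c * Y * Δ ^ 2 ∧ ‖(fun j => σ (β j)) - ω‖ ≤ Real.exp (-((Δ * Height.logHeight (Fin.cons (1 : K) β : Fin (3 + 1) → K) + Y * Module.finrank ℚ K) / c)) := by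
  sorry

/-- **Stub `stub_pointAP_four_le` — `PointAPAbsAt t` for `t ≥ 4`** (NOT staffed): AP2 for `n ≥ 4`, containing
Philippon's CONJECTURE AP1 (`d' = 0`, `n ≥ 4`; LNM 1752 Ch. 4 §4 p. 61; Philippon's "seul obstacle", IJNT 7 (2011)).
Docking point of line `arithmetic-chardin-philippon`. Why it might fail: it is (a strengthening of) an open problem. -/
theorem stub_pointAP_four_le : ∀ t : ℕ, 4 ≤ t → PointAPAbsAt t := by
  sorry

/-! ## Wave 1 of c14 LANDED: `midLowSmall3_normalForm` (…MidLowSmallNormalForm.lean, p166175) is imported by name. -/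

/-! ## Glue: v27b's mid-low-small stub from its normal form -/

/-- **`pointDatum_of_midLowSmall3`** (v27b's open stub, its registered signature verbatim) from
`pointDatum_of_midLowSmall3NF` and `midLowSmall3_normalForm`: take the NF stub's constants with `η := 1` (the degree
hypothesis `deg 𝔮' < ηΔ²` is no longer used), unpack the datum and the low-small-surface hypothesis, derive the three
normal-form conjuncts and feed the NF stub. [folklore] -/
theorem pointDatum_of_midLowSmall3 : ∀ (ω : Fin 3 → ℂ) (c₁ : ℝ), 1 ≤ c₁ → ∃ δstar : ℕ, 1 ≤ δstar ∧ ∃ K₀ : ℕ, 1 ≤ K₀ ∧ ∃ C₄ : ℝ, c₁ ≤ C₄ ∧ ∃ η : ℝ, 0 < η ∧ ∃ M₁ : ℝ, 64 * c₁ ≤ M₁ ∧ ∃ lam : ℝ, 1 ≤ lam ∧ ∃ c : ℝ, c₁ ≤ c ∧ ∀ Δ Y : ℝ, c ≤ Δ → Δ ≤ Y → ∀ (Q : Rx 3) (a : ℕ) (P : Rx 3) (b : ℕ) (𝔮 : Ideal (Rx 3)) (T : Rx 3) (τ : ℕ) (𝔭 𝔮' : Ideal (Rx 3)), CycleAP3Datum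 ω c₁ Δ (lam * Y) Q a P b 𝔮 T τ 𝔭 → 𝔮'.IsPrime → 𝔮'.IsHomogeneous (homogeneousSubmodule (Fin (3 + 1)) ℚ) → IsUnmixedOfRank 𝔮' 2 → 𝔮' ∈ (Ideal.span {Q} ⊔ Ideal.span {P}).minimalPrimes → Ideal.span {Q} ⊔ Ideal.span {P} ⊔ Ideal.span {T} ≤ 𝔮' → 𝔮' < 𝔭 → δstar < ideg 𝔮' 2 → a + b + ⌊Δ⌋₊ ≤ τ → Module.finrank ℚ ↥(homogeneousSubmodule (Fin (3 + 1)) ℚ τ) < Module.finrank ℚ ↥(homogeneousSubmodule (Fin (3 + 1)) ℚ τ ⊓ 𝔮'.restrictScalars ℚ) + 2 * ⌊Δ⌋₊ * ideg 𝔮 2 → ⌊c₁ * Δ⌋₊ + 1 < ideg 𝔭 1 → ¬ (Module.finrank ℚ ↥(homogeneousSubmodule (Fin (3 + 1)) ℚ ⌊c₁ * Δ⌋₊) = Module.finrank ℚ ↥(homogeneousSubmodule (Fin (3 + 1)) ℚ ⌊c₁ * Δ⌋₊ ⊓ 𝔭.restrictScalars ℚ) + ideg 𝔭 1) → homogeneousSubmodule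 (Fin (3 + 1)) ℚ ⌊C₄ * Δ⌋₊ ⊓ 𝔭.restrictScalars ℚ ≤ 𝔮'.restrictScalars ℚ → K₀ * Module.finrank ℚ ↥(homogeneousSubmodule (Fin (3 + 1)) ℚ ⌊C₄ * Δ⌋₊) < ideg 𝔭 1 + K₀ * Module.finrank ℚ ↥(homogeneousSubmodule (Fin (3 + 1)) ℚ ⌊C₄ * Δ⌋₊ ⊓ 𝔭.restrictScalars ℚ) → (ideg 𝔮' 2 : ℝ) < η * Δ ^ 2 → (∃ (F Q₂ : Rx 3) (d a₂ : ℕ), F ≠ 0 ∧ F.IsHomogeneous d ∧ 1 ≤ d ∧ (d : ℝ) ≤ Δ / M₁ ∧ height F ≤ lam * Y / c₁ ∧ Q₂ ≠ 0 ∧ Q₂.IsHomogeneous a₂ ∧ 1 ≤ a₂ ∧ a₂ ≤ d ∧ (Ideal.span {Q₂}).IsPrime ∧ Q₂ ∣ F ∧ Q₂ ∈ 𝔮' ∧ height Q₂ ≤ lam * Y / c₁ + 4 * Δ / M₁ ∧ normAt (Fin.cons 1 ω) Q₂ ≤ Real.exp (-((a₂ : ℝ) * (Δ / M₁) ^ 2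 * (lam * Y) / (3200 * c₁)))) → ∃ (K : Type) (_ : Field K) (_ : NumberField K) (β : Fin 3 → K) (σ : K →+* ℂ), (Module.finrank ℚ K : ℝ) ≤ (c * Δ) ^ 3 ∧ Height.logHeight (Fin.cons (1 : K) β : Fin (3 + 1) → K) ≤ c * Y * Δ ^ 2 ∧ ‖(fun j => σ (β j)) - ω‖ ≤ Real.exp (-((Δ * Height.logHeight (Fin.cons (1 : K) β : Fin (3 + 1) → K) + Y * Module.finrank ℚ K) / c)) := by
  intro ω c₁ hc₁
  obtain ⟨δstar, hδ, K₀, hK₀, C₄, hC₄, M₁, hM₁, lam, hlam, c, hc, hnf⟩ := pointDatum_of_midLowSmall3NF ω c₁ hc₁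
  refine ⟨δstar, hδ, K₀, hK₀, C₄, hC₄, 1, one_pos, M₁, hM₁, lam, hlam, c, hc, ?_⟩
  intro Δ Y hΔ hY Q a P b 𝔮 T τ 𝔭 𝔮' hdat h1 h2 h3 h4 h5 h6 h7 h8 h9 h10 h11 h12 h13 _hcase hlow
  obtain ⟨F, Q₂, d, a₂, hF0, hFhom, hd1, hdM, hFh, hQ₂0, hQ₂hom, ha₂1, ha₂d, hQ₂p, hdvd, hQ₂𝔮', hQ₂h, hQ₂small⟩ :=
    hlow
  obtain ⟨hQ0, hQhom, ha1, haΔ, hQprime, hPhom, hb1, hbΔ, hPQ, h𝔮p, h𝔮h, h𝔮u, hQ𝔮, hP𝔮, -, -, -, -, -, -, -,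
    h𝔭p, h𝔭h, h𝔭u, h𝔮𝔭, -, -, -, -, -⟩ := id hdat
  have hQ𝔮' : Q ∈ 𝔮' := h5 (Ideal.mem_sup_left (Ideal.mem_sup_left (Ideal.mem_span_singleton_self Q)))
  have hP𝔮' : P ∈ 𝔮' := h5 (Ideal.mem_sup_left (Ideal.mem_sup_right (Ideal.mem_span_singleton_self P)))
  obtain ⟨hδ', hassoc, hsplit⟩ := midLowSmall3_normalForm Δ M₁ Q a P b 𝔮 𝔭 𝔮' Q₂ a₂ d hQ0 hQhom ha1 haΔ
    hQprime hPhom hb1 hbΔ hPQ h𝔮p h𝔮h h𝔮u hQ𝔮 hP𝔮 h𝔭p h𝔭h h𝔭u h𝔮𝔭 h1 h2 h3 hQ𝔮' hP𝔮' h6.le hQ₂0 hQ₂hom ha₂1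
    ha₂d hdM hQ₂𝔮'
  exact hnf Δ Y hΔ hY Q a P b 𝔮 T τ 𝔭 𝔮' hdat h1 h2 h3 h4 h5 h6 h7 h8 h9 h10 h11 h12 h13
    ⟨F, Q₂, d, a₂, hF0, hFhom, hd1, hdM, hFh, hQ₂0, hQ₂hom, ha₂1, ha₂d, hQ₂p, hdvd, hQ₂𝔮', hQ₂h, hQ₂small, hδ',
      hassoc, hsplit⟩

/-! ## Glue: the small-low-surface dichotomy, and v25's mid stub from it and the mid-low-small stub (boosts multiplied) -/

/-- **`pointDatum_or_smallLowSurface3`** — the strengthened low-surface dichotomy, unconditionally in the skeleton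
(composition of the two provable stubs). [folklore] -/
theorem pointDatum_or_smallLowSurface3 : ∀ (ω : Fin 3 → ℂ) (c₁ : ℝ), 1 ≤ c₁ → ∀ C₄ : ℝ, c₁ ≤ C₄ → ∀ M₁ : ℝ, 64 * c₁ ≤ M₁ → ∃ lam : ℝ, 1 ≤ lam ∧ ∃ c : ℝ, c₁ ≤ c ∧ ∀ Δ Y : ℝ, c ≤ Δ → Δ ≤ Y → ∀ (Q : Rx 3) (a : ℕ) (P : Rx 3) (b : ℕ) (𝔮 : Ideal (Rx 3)) (T : Rx 3) (τ : ℕ) (𝔭 𝔮' : Ideal (Rx 3)), CycleAP3Datum ω c₁ Δ (lam * Y) Q a P b 𝔮 T τ 𝔭 → 𝔮'.IsPrime → IsUnmixedOfRank 𝔮' 2 → 𝔮' ≤ 𝔭 → homogeneousSubmodule (Fin (3 + 1)) ℚ ⌊C₄ * Δ⌋₊ ⊓ 𝔭.restrictScalars ℚ ≤ 𝔮'.restrictScalars ℚ → (∃ (K : Type) (_ : Field K) (_ : NumberField K) (β : Fin 3 → K) (σ : K →+* ℂ), (Module.finrank ℚ K : ℝ) ≤ (c * Δ) ^ 3 ∧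 Height.logHeight (Fin.cons (1 : K) β : Fin (3 + 1) → K) ≤ c * Y * Δ ^ 2 ∧ ‖(fun j => σ (β j)) - ω‖ ≤ Real.exp (-((Δ * Height.logHeight (Fin.cons (1 : K) β : Fin (3 + 1) → K) + Y * Module.finrank ℚ K) / c))) ∨ (∃ (F Q₂ : Rx 3) (d a₂ : ℕ), F ≠ 0 ∧ F.IsHomogeneous d ∧ 1 ≤ d ∧ (d : ℝ) ≤ Δ / M₁ ∧ height F ≤ lam * Y / c₁ ∧ Q₂ ≠ 0 ∧ Q₂.IsHomogeneous a₂ ∧ 1 ≤ a₂ ∧ a₂ ≤ d ∧ (Ideal.span {Q₂}).IsPrime ∧ Q₂ ∣ F ∧ Q₂ ∈ 𝔮' ∧ height Q₂ ≤ lam * Y / c₁ + 4 * Δ / M₁ ∧ normAt (Fin.cons 1 ω) Q₂ ≤ Real.exp (-((a₂ : ℝ) * (Δ / M₁) ^ 2 * (lam * Y) / (3200 * c₁)))) :=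
  pointDatum_or_smallLowSurface3_of primePartSplit3

/-- **`pointDatum_of_midSatellite3`** (v25's open stub, its registered signature verbatim) from
`pointDatum_or_smallLowSurface3` and `pointDatum_of_midLowSmall3`: take the mid-low-small stub's `δ⋆, K₀, C₄, η, M₁`, run
the small-low-surface dichotomy at the height scale `λ_M·Y`, and feed its second branch to the mid-low-small stub at the
height scale `λ_L·Y` (the two boosts commute: `λ_L(λ_M Y) = λ_M(λ_L Y)`). [folklore] -/
theorem pointDatum_of_midSatellite3 : ∀ (ω : Fin 3 → ℂ) (c₁ : ℝ), 1 ≤ c₁ → ∃ δstar : ℕ, 1 ≤ δstar ∧ ∃ K₀ : ℕ, 1 ≤ K₀ ∧ ∃ C₄ : ℝ, c₁ ≤ C₄ ∧ ∃ η : ℝ, 0 < η ∧ ∃ lam : ℝ, 1 ≤ lam ∧ ∃ c : ℝ, c₁ ≤ c ∧ ∀ Δ Y : ℝ, c ≤ Δ → Δ ≤ Y → ∀ (Q : Rx 3) (a : ℕ) (P : Rx 3) (b : ℕ) (𝔮 : Ideal (Rx 3)) (T : Rx 3) (τ : ℕ) (𝔭 𝔮' : Ideal (Rx 3)), CycleAP3Datum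 ω c₁ Δ (lam * Y) Q a P b 𝔮 T τ 𝔭 → 𝔮'.IsPrime → 𝔮'.IsHomogeneous (homogeneousSubmodule (Fin (3 + 1)) ℚ) → IsUnmixedOfRank 𝔮' 2 → 𝔮' ∈ (Ideal.span {Q} ⊔ Ideal.span {P}).minimalPrimes → Ideal.span {Q} ⊔ Ideal.span {P} ⊔ Ideal.span {T} ≤ 𝔮' → 𝔮' < 𝔭 → δstar < ideg 𝔮' 2 → a + b + ⌊Δ⌋₊ ≤ τ → Module.finrank ℚ ↥(homogeneousSubmodule (Fin (3 + 1)) ℚ τ) < Module.finrank ℚ ↥(homogeneousSubmodule (Fin (3 + 1)) ℚ τ ⊓ 𝔮'.restrictScalars ℚ) + 2 * ⌊Δ⌋₊ * ideg 𝔮 2 → ⌊c₁ * Δ⌋₊ + 1 < ideg 𝔭 1 → ¬ (Module.finrank ℚ ↥(homogeneousSubmodule (Fin (3 + 1)) ℚ ⌊c₁ * Δ⌋₊) = Module.finrank ℚ ↥(homogeneousSubmodule (Fin (3 + 1)) ℚ ⌊c₁ * Δ⌋₊ ⊓ 𝔭.restrictScalars ℚ) + ideg 𝔭 1) → homogeneousSubmodule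 (Fin (3 + 1)) ℚ ⌊C₄ * Δ⌋₊ ⊓ 𝔭.restrictScalars ℚ ≤ 𝔮'.restrictScalars ℚ → K₀ * Module.finrank ℚ ↥(homogeneousSubmodule (Fin (3 + 1)) ℚ ⌊C₄ * Δ⌋₊) < ideg 𝔭 1 + K₀ * Module.finrank ℚ ↥(homogeneousSubmodule (Fin (3 + 1)) ℚ ⌊C₄ * Δ⌋₊ ⊓ 𝔭.restrictScalars ℚ) → (ideg 𝔮' 2 : ℝ) < η * Δ ^ 2 → ∃ (K : Type) (_ : Field K) (_ : NumberField K) (β : Fin 3 → K) (σ : K →+* ℂ), (Module.finrank ℚ K : ℝ) ≤ (c * Δ) ^ 3 ∧ Height.logHeight (Fin.cons (1 : K) β : Fin (3 + 1) → K) ≤ c * Y * Δ ^ 2 ∧ ‖(fun j => σ (β j)) - ω‖ ≤ Real.exp (-((Δ * Height.logHeight (Fin.cons (1 : K) β : Fin (3 + 1) → K) + Y * Module.finrank ℚ K) / c)) := by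
  intro ω c₁ hc₁
  obtain ⟨δstar, hδ, K₀, hK₀, C₄, hC₄, η, hη, M₁, hM₁, lamM, hlamM, cM, hcM, hmid⟩ :=
    pointDatum_of_midLowSmall3 ω c₁ hc₁
  obtain ⟨lamL, hlamL, cL, hcL, hlow⟩ := pointDatum_or_smallLowSurface3 ω c₁ hc₁ C₄ hC₄ M₁ hM₁
  have hcM0 : 0 < cM := by linarith
  have hcL0 : 0 < cL := by linarith
  have hc₁0 : 0 < c₁ := by linarith
  refine ⟨δstar, hδ, K₀, hK₀, C₄, hC₄, η, hη, lamM * lamL, one_le_mul_of_one_le_of_one_le hlamM hlamL,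
    max (cM * lamL) (cL * lamM), ?_, ?_⟩
  · exact le_trans hcM (le_trans (le_mul_of_one_le_right hcM0.le hlamL) (le_max_left _ _))
  intro Δ Y hΔ hY Q a P b 𝔮 T τ 𝔭 𝔮' hdat h1 h2 h3 h4 h5 h6 h7 h8 h9 h10 h11 h12 h13 hcase
  have hcMΔ : cM ≤ Δ := le_trans (le_trans (le_mul_of_one_le_right hcM0.le hlamL) (le_max_left _ _)) hΔ
  have hcLΔ : cL ≤ Δ := le_trans (le_trans (le_mul_of_one_le_right hcL0.le hlamM) (le_max_right _ _)) hΔ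
  have hΔ0 : 0 ≤ Δ := by linarith
  have hY0 : 0 ≤ Y := by linarith
  -- the small-low-surface dichotomy at the height scale `lamM * Y`
  have hY₁ : Δ ≤ lamM * Y := le_trans hY (le_mul_of_one_le_left hY0 hlamM)
  have hdat₁ : CycleAP3Datum ω c₁ Δ (lamL * (lamM * Y)) Q a P b 𝔮 T τ 𝔭 := by
    rw [show lamL * (lamM * Y) = lamM * lamL * Y by ring]; exact hdat
  rcases hlow Δ (lamM * Y) hcLΔ hY₁ Q a P b 𝔮 T τ 𝔭 𝔮' hdat₁ h1 h3 h6.le h12 with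
    ⟨K, iF, iN, β, σ, hd, hh, hacc⟩ |
    ⟨F, Q₂, d, a₂, hF0, hFhom, hd1, hdM, hFh, hQ₂0, hQ₂hom, ha₂1, ha₂d, hQ₂p, hdvd, hQ₂𝔮', hQ₂h, hQ₂small⟩
  · refine ⟨K, iF, iN, β, σ, ?_, ?_, ?_⟩
    · exact hd.trans (pow_le_pow_left₀ (by positivity)
        (mul_le_mul_of_nonneg_right (le_trans (le_mul_of_one_le_right hcL0.le hlamM) (le_max_right _ _)) hΔ0) 3)
    · calc _ ≤ cL * (lamM * Y) * Δ ^ 2 := hh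
        _ = (cL * lamM) * Y * Δ ^ 2 := by ring
        _ ≤ max (cM * lamL) (cL * lamM) * Y * Δ ^ 2 := by gcongr; exact le_max_right _ _
    · exact hacc.trans (PointAPThreeMid.exp_datum_mono (Height.logHeight_nonneg _) (Nat.cast_nonneg _) hΔ0 hY0
        (le_mul_of_one_le_left hY0 hlamM) hcL0
        (le_trans (le_mul_of_one_le_right hcL0.le hlamM) (le_max_right _ _)))
  · -- the mid-low-small stub at the height scale `lamL * Y`
    have hY₂ : Δ ≤ lamL * Y := le_trans hY (le_mul_of_one_le_left hY0 hlamL)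
    have hdat₂ : CycleAP3Datum ω c₁ Δ (lamM * (lamL * Y)) Q a P b 𝔮 T τ 𝔭 := by
      rw [show lamM * (lamL * Y) = lamM * lamL * Y by ring]; exact hdat
    have hFh₂ : height F ≤ lamM * (lamL * Y) / c₁ := by
      rw [show lamM * (lamL * Y) / c₁ = lamL * (lamM * Y) / c₁ by ring]; exact hFh
    have hQ₂h₂ : height Q₂ ≤ lamM * (lamL * Y) / c₁ + 4 * Δ / M₁ := by
      rw [show lamM * (lamL * Y) / c₁ = lamL * (lamM * Y) / c₁ by ring]; exact hQ₂h
    have hQ₂small₂ : normAt (Fin.cons 1 ω) Q₂ ≤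
        Real.exp (-((a₂ : ℝ) * (Δ / M₁) ^ 2 * (lamM * (lamL * Y)) / (3200 * c₁))) := by
      rw [show lamM * (lamL * Y) = lamL * (lamM * Y) by ring]; exact hQ₂small
    obtain ⟨K, iF, iN, β, σ, hd, hh, hacc⟩ :=
      hmid Δ (lamL * Y) hcMΔ hY₂ Q a P b 𝔮 T τ 𝔭 𝔮' hdat₂ h1 h2 h3 h4 h5 h6 h7 h8 h9 h10 h11 h12 h13 hcase
        ⟨F, Q₂, d, a₂, hF0, hFhom, hd1, hdM, hFh₂, hQ₂0, hQ₂hom, ha₂1, ha₂d, hQ₂p, hdvd, hQ₂𝔮', hQ₂h₂, hQ₂small₂⟩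
    refine ⟨K, iF, iN, β, σ, ?_, ?_, ?_⟩
    · exact hd.trans (pow_le_pow_left₀ (by positivity)
        (mul_le_mul_of_nonneg_right (le_trans (le_mul_of_one_le_right hcM0.le hlamL) (le_max_left _ _)) hΔ0) 3)
    · calc _ ≤ cM * (lamL * Y) * Δ ^ 2 := hh
        _ = (cM * lamL) * Y * Δ ^ 2 := by ring
        _ ≤ max (cM * lamL) (cL * lamM) * Y * Δ ^ 2 := by gcongr; exact le_max_left _ _
    · exact hacc.trans (PointAPThreeMid.exp_datum_mono (Height.logHeight_nonneg _) (Nat.cast_nonneg _) hΔ0 hY0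
        (le_mul_of_one_le_left hY0 hlamL) hcM0
        (le_trans (le_mul_of_one_le_right hcM0.le hlamL) (le_max_left _ _)))

/-! ## Composition BY NAME over the landed record …PointAPThreeMid.lean (p154747) -/

/-- v23b's far stub, now a theorem of the skeleton (landed `farSatellite3_def_of_mid` over the mid stub). -/
theorem pointDatum_of_farSatellite3_def : ∀ (ω : Fin 3 → ℂ) (c₁ : ℝ), 1 ≤ c₁ → ∃ δstar : ℕ, 1 ≤ δstar ∧ ∃ K₀ : ℕ, 1 ≤ K₀ ∧ ∃ C₄ : ℝ, c₁ ≤ C₄ ∧ ∃ lam : ℝ, 1 ≤ lam ∧ ∃ c : ℝ, c₁ ≤ c ∧ ∀ Δ Y : ℝ, c ≤ Δ → Δ ≤ Y → ∀ (Q : Rx 3) (a : ℕ) (P : Rx 3) (b : ℕ) (𝔮 : Ideal (Rx 3)) (T : Rx 3) (τ : ℕ) (𝔭 𝔮' : Ideal (Rx 3)), CycleAP3Datum ω c₁ Δ (lam * Y) Q a P b 𝔮 T τ 𝔭 → 𝔮'.IsPrime → 𝔮'.IsHomogeneous (homogeneousSubmodule (Fin (3 + 1)) ℚ) → IsUnmixedOfRank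 𝔮' 2 → 𝔮' ∈ (Ideal.span {Q} ⊔ Ideal.span {P}).minimalPrimes → Ideal.span {Q} ⊔ Ideal.span {P} ⊔ Ideal.span {T} ≤ 𝔮' → 𝔮' < 𝔭 → δstar < ideg 𝔮' 2 → a + b + ⌊Δ⌋₊ ≤ τ → Module.finrank ℚ ↥(homogeneousSubmodule (Fin (3 + 1)) ℚ τ) < Module.finrank ℚ ↥(homogeneousSubmodule (Fin (3 + 1)) ℚ τ ⊓ 𝔮'.restrictScalars ℚ) + 2 * ⌊Δ⌋₊ * ideg 𝔮 2 → ⌊c₁ * Δ⌋₊ + 1 < ideg 𝔭 1 → ¬ (Module.finrank ℚ ↥(homogeneousSubmodule (Fin (3 + 1)) ℚ ⌊c₁ * Δ⌋₊) = Module.finrank ℚ ↥(homogeneousSubmodule (Fin (3 + 1)) ℚ ⌊c₁ * Δ⌋₊ ⊓ 𝔭.restrictScalars ℚ) + ideg 𝔭 1) → homogeneousSubmodule (Fin (3 + 1)) ℚ ⌊C₄ * Δ⌋₊ ⊓ 𝔭.restrictScalars ℚ ≤ 𝔮'.restrictScalars ℚ → K₀ * Module.finrank ℚ ↥(homogeneousSubmodule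 (Fin (3 + 1)) ℚ ⌊C₄ * Δ⌋₊) < ideg 𝔭 1 + K₀ * Module.finrank ℚ ↥(homogeneousSubmodule (Fin (3 + 1)) ℚ ⌊C₄ * Δ⌋₊ ⊓ 𝔭.restrictScalars ℚ) → ∃ (K : Type) (_ : Field K) (_ : NumberField K) (β : Fin 3 → K) (σ : K →+* ℂ), (Module.finrank ℚ K : ℝ) ≤ (c * Δ) ^ 3 ∧ Height.logHeight (Fin.cons (1 : K) β : Fin (3 + 1) → K) ≤ c * Y * Δ ^ 2 ∧ ‖(fun j => σ (β j)) - ω‖ ≤ Real.exp (-((Δ * Height.logHeight (Fin.cons (1 : K) β : Fin (3 + 1) → K) + Y * Module.finrank ℚ K) / c)) :=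
  farSatellite3_def_of_mid pointDatum_of_midSatellite3

/-- **`PointAPAbsAt 3`** — Philippon's AP2 for `n = 3` with pointwise constants, from the mid kernel (landed
`pointAPAt3_of_mid`). -/
theorem PointAPAt3 : PointAPAbsAt 3 :=
  pointAPAt3_of_mid pointDatum_of_midSatellite3

/-- **The crux from the line** — the ONLY theorem of this file whose conclusion is
`Summit.Schanuel.Schanuel.Theses.DiophantineDichotomy.ApproximationProperty`, BY NAME; no hypotheses (landed
`approximationProperty_of_mid`, p154747, over `approximationProperty_of_farDef` p140489 and
`approximationProperty_of_pointAP_three_le` p130702). -/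
theorem ApproximationProperty_of : ApproximationProperty :=
  approximationProperty_of_mid pointDatum_of_midSatellite3 stub_pointAP_four_le

/-! ## Signpost (kernel-checked, conditional on the open stubs only; conclusion head is NOT the crux) -/

/-- The `t = 3` slice of the crux from the mid kernel ALONE (landed `slice_three_of_mid`). -/
theorem slice_three : PointwiseAPSlice 3 :=
  slice_three_of_mid pointDatum_of_midSatellite3

end

end Summit.Schanuel.Schanuel.Cruxes.ApproximationProperty.OrbitInterpolationDeterminant
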